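import Mathlib.Tactic
import HarnessLib

/-!
# Kozma–Nitzan's Question 8 at three relays — the EXPLICIT Q-split for c ≤ 0 and the LEAF condition of CONJECTURE Θ⁻ (gen 24)

Support file (`--supports stmt-CriticalPhenomena-4575`, closed crux; independent mathematics on Kozma–Nitzan's Question 8,
arXiv:2401.12397 §5.5 p. 36), prover `prim-ineq-gen-6` (gen 24).  No definitions, no named facts, no sorries; standard axioms.
Memo `run/shared/lean/prim/prim-ineq-gen-6/PROOF-THETA-G24.md` (LEMMA Θ §1, THEOREM L₀ §5).

For a path-end block `T = a –s– T₁` the two-level pair `(Ψ¹ ; Ψ⁰)` of the C3 corner has class densities `x` (level 1, kernel `K₁`),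
`y` (level 0, `K₁`) and `β` (level 0, `K₀`), with `K₀ ≼ K₁` configurationwise.  LEMMA Θ: the crossing weight `q := (y+β)⁻` makes the
level-0 half `Ψ⁰ + Q` nonnegative TERM BY TERM (`levelZero_termwise_nonneg`, an order lemma: the sign pattern `β ≤ 0 ∨ 0 ≤ y` always
holds, PROOF-C3-PATHEND-G22 LEMMA 3), so `P(T)` reduces to the ancestor-transport feasibility of `x − (y+β)⁻`; for `c ≤ 0` this is the
total class density `G₀ = x+y+β = Φσ − (Φσ−c)α̂ − (Φ+m−c)γ̂ + Xμ̂` of `θ‴_T` (`X = (Φ+m)Φ − c`), whose `λ̃`-mean vanishes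
(`theta_G0_mean_zero`: `Φσ = (Φσ−c)ε + (Φ+m−c)π − Xm`, from `cΦ = D(πΦ−m)`).  CONJECTURE Θ⁻ (memo §0(2)) asks that `G₀` be feasible for
the ancestor transport; by the single-edge criterion (memo §3) this is `n−1` scalar inequalities, the first of which is the LEAF condition
`G₀({a}) ≤ 0`.  THEOREM L₀ (memo §5) proves it for every block with `c ≤ 0`; `theta_leaf_nonneg` is that proof as a polynomial inequality
in the seven numbers `(A, C, s, Φ₁, π₁, ε₁, m₁)` (root parameters `A = A_a`, `C = C_a`, edge weight `s`, in-moments of `T₁`), multiplied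
through by `Φ > 0`: with `p̃ = (1−s)Φ₁ + sπ₁`, `ẽ, m̃` likewise, `π = Cp̃`, `ε = Aẽ`, `m = ACm̃`, `Φ = π+ε−m`, `σ = π+m`, `c̄ := cΦ = (ε−m)(πΦ−m)`,
   `Φ·κ̂ = (Φ²σ − c̄)·A(π₁−m₁) + (Φ(Φ+m) − c̄)·C(ε₁−m₁) − (Φ²(Φ+m) − c̄)·AC(π₁+ε₁−2m₁) ≥ 0`   whenever `πΦ ≤ m` (i.e. `c ≤ 0` with `D > 0`),
and `G₀({a}) = −s·κ̂`.  The proof is the memo's: `Φκ̂ = A(π₁−m₁)(1−C)(Φ²π − c̄) + (ε₁−m₁)·W` with `W ≥ 0` by the chain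
`sA²Φ²C(π₁−m₁) ≤ A²ΦC(A−Φ)m̃ ≤ CΦ(Φ+m)(1−AΦ) ≤ C(Φ(Φ+m)−c̄)(1−A) + CAΦ(Φ+m)(1−Φ)`, whose first step is the hypothesis `πΦ ≤ m`.
[cite: KozmaNitzan2024, Question 8 (§5.5 p. 36)]
-/

namespace Summit.CriticalPhenomena.PercolationContinuityZ3.Theorems

namespace PocketCert

/-- **LEMMA Θ (termwise level 0).**  At one configuration let `k₁ ≥ k₀ ≥ 0` be the values of the kernels `K₁ ≽ K₀` on an up-set, `y` the
level-0 `K₁`-density, `b` the `K₀`-density, and `q := (y+b)⁻ = max 0 (−(y+b))` the crossing weight.  If `b ≤ 0 ∨ 0 ≤ y` (always the case: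
`b > 0` only occurs for `c > 0`, where `y ≥ 0`), then `(y + q)·k₁ + b·k₀ ≥ 0`. [cite: KozmaNitzan2024, Question 8 (§5.5 p. 36)] -/
theorem levelZero_termwise_nonneg (y b k₁ k₀ : ℝ) (hk₀ : 0 ≤ k₀) (hk : k₀ ≤ k₁) (hsign : b ≤ 0 ∨ 0 ≤ y) :
    0 ≤ (y + max 0 (-(y + b))) * k₁ + b * k₀ := by
  rcases le_or_gt 0 (y + b) with hyb | hyb
  · have hq : max 0 (-(y + b)) = 0 := max_eq_left (by linarith)
    rw [hq, add_zero]
    rcases hsign with hb | hy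
    · -- y k₁ + b k₀ = (y+b) k₁ + (-b)(k₁ - k₀)
      nlinarith [mul_nonneg hyb (le_trans hk₀ hk), mul_nonneg (neg_nonneg.2 hb) (sub_nonneg.2 hk)]
    · nlinarith [mul_nonneg hy (le_trans hk₀ hk), mul_nonneg hyb hk₀]
  · have hq : max 0 (-(y + b)) = -(y + b) := max_eq_right (by linarith)
    rw [hq]
    have hb : b ≤ 0 := by
      rcases hsign with hb | hy
      · exact hb
      · linarith
    nlinarith [mul_nonneg (neg_nonneg.2 hb) (sub_nonneg.2 hk)]

/-- **Mean zero of the θ‴ class density.**  With `Φ = π+ε−m`, `σ = π+m`, `D = ε−m` and the defining relation `cΦ = D(πΦ−m)` of the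
out-defect `c`, the coefficients of `G₀ = Φσ − (Φσ−c)α̂ − (Φ+m−c)γ̂ + ((Φ+m)Φ−c)μ̂` integrate to zero against the moments `(ε,π,m)`:
`Φσ = (Φσ−c)ε + (Φ+m−c)π − ((Φ+m)Φ − c)m`. [cite: KozmaNitzan2024, Question 8 (§5.5 p. 36)] -/
theorem theta_G0_mean_zero (π ε m c : ℝ) (hc : c * (π + ε - m) = (ε - m) * (π * (π + ε - m) - m)) :
    (π + ε - m) * (π + m)
      = ((π + ε - m) * (π + m) - c) * ε + ((π + ε - m) + m - c) * π - (((π + ε - m) + m) * (π + ε - m) - c) * m := by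
  linear_combination hc

set_option maxHeartbeats 400000 in
/-- **THEOREM L₀ (leaf condition of CONJECTURE Θ⁻), polynomial form.**  Root parameters `A, C ∈ [0,1]`, root-edge weight `s ∈ [0,1]`,
in-moments `(π₁, ε₁, m₁)` of `T₁` with `0 ≤ m₁ ≤ π₁, ε₁` and `Φ₁ ≥ 0`; `pt, et, mt` the moments of `T` with unit root parameters,
`π = C·pt`, `ε = A·et`, `m = AC·mt`, `Φ = π+ε−m ≤ 1`, `σ = π+m`, `cb = cΦ = (ε−m)(πΦ−m)`.  If `πΦ ≤ m` (the sign condition `c ≤ 0`), then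
`Φκ̂ = (Φ²σ − cb)A(π₁−m₁) + (Φ(Φ+m) − cb)C(ε₁−m₁) − (Φ²(Φ+m) − cb)AC(π₁+ε₁−2m₁) ≥ 0`, i.e. the θ‴ class density of the class `{a}` is `≤ 0`.
[cite: KozmaNitzan2024, Question 8 (§5.5 p. 36)] -/
theorem theta_leaf_nonneg (A C s Φ₁ π₁ ε₁ m₁ pt et mt π ε m Φ σ cb : ℝ)
    (hpt : pt = (1 - s) * Φ₁ + s * π₁) (het : et = (1 - s) * Φ₁ + s * ε₁) (hmt : mt = (1 - s) * Φ₁ + s * m₁)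
    (hπ : π = C * pt) (hε : ε = A * et) (hm : m = A * C * mt) (hΦ : Φ = π + ε - m) (hσ : σ = π + m)
    (hcb : cb = (ε - m) * (π * Φ - m))
    (hA0 : 0 ≤ A) (hA1 : A ≤ 1) (hC0 : 0 ≤ C) (hC1 : C ≤ 1) (hs0 : 0 ≤ s) (hs1 : s ≤ 1) (hΦ₁ : 0 ≤ Φ₁)
    (hm0 : 0 ≤ m₁) (hmπ : m₁ ≤ π₁) (hmε : m₁ ≤ ε₁) (hΦ1 : Φ ≤ 1) (hc : π * Φ ≤ m) :
    0 ≤ (Φ ^ 2 * σ - cb) * (A * (π₁ - m₁)) + (Φ * (Φ + m) - cb) * (C * (ε₁ - m₁))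
        - (Φ ^ 2 * (Φ + m) - cb) * (A * C * (π₁ + ε₁ - 2 * m₁)) := by
  -- elementary bounds on the unit-root moments
  have hmt0 : 0 ≤ mt := by rw [hmt]; nlinarith
  have hptmt : mt ≤ pt := by rw [hmt, hpt]; nlinarith
  have hetmt : mt ≤ et := by rw [hmt, het]; nlinarith
  have hπ0 : 0 ≤ π := by rw [hπ]; exact mul_nonneg hC0 (le_trans hmt0 hptmt)
  -- Φ + m = C pt + A et ≥ (A + C) mt  and  Φ ≥ 0
  have hΦm : (A + C) * mt ≤ Φ + m := by
    rw [hΦ, hπ, hε, hm]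
    nlinarith [mul_le_mul_of_nonneg_left hptmt hC0, mul_le_mul_of_nonneg_left hetmt hA0]
  have hm_le : m ≤ C * mt := by
    rw [hm]; nlinarith [mul_nonneg hC0 hmt0]
  have hΦ0 : 0 ≤ Φ := by nlinarith [mul_nonneg hA0 hmt0, mul_nonneg hC0 hmt0]
  -- D = ε − m ≥ 0 and cb ≤ 0
  have hD : 0 ≤ ε - m := by
    rw [hε, hm]
    have : A * C * mt ≤ A * et := by nlinarith [mul_le_mul_of_nonneg_left hetmt hA0, mul_nonneg hA0 (mul_nonneg hC0 hmt0), mul_nonneg hA0 hmt0]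
    linarith
  have hcb0 : cb ≤ 0 := by
    rw [hcb]
    have h' : π * Φ - m ≤ 0 := by linarith
    exact mul_nonpos_iff.2 (Or.inl ⟨hD, h'⟩)
  -- (i) the first piece
  have h1 : 0 ≤ A * (π₁ - m₁) * (1 - C) * (Φ ^ 2 * π - cb) := by
    have hp : 0 ≤ Φ ^ 2 * π - cb := by nlinarith [mul_nonneg (sq_nonneg Φ) hπ0]
    exact mul_nonneg (mul_nonneg (mul_nonneg hA0 (sub_nonneg.2 hmπ)) (sub_nonneg.2 hC1)) hp
  -- (ii) the chain for W
  have h2 : s * Φ * C * (π₁ - m₁) ≤ C * (A - Φ) * mt := by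
    have e : C * (A - Φ) * mt - s * Φ * C * (π₁ - m₁) = A * C * mt - C * pt * Φ := by
      rw [hmt, hpt]; ring
    have hc' : 0 ≤ A * C * mt - C * pt * Φ := by
      have h'' := hc
      rw [hπ, hm] at h''
      linarith
    linarith [e, hc']
  have h3a : A ^ 2 * (A - Φ) ≤ A * (1 - A * Φ) := by
    nlinarith [mul_nonneg (mul_nonneg hA0 (sub_nonneg.2 hA1)) (show (0:ℝ) ≤ A + 1 by linarith)]
  have hAΦ : 0 ≤ 1 - A * Φ := by nlinarith [mul_le_mul hA1 hΦ1 hΦ0 (by norm_num : (0:ℝ) ≤ 1)]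
  have t1 : s * A ^ 2 * Φ ^ 2 * C * (π₁ - m₁) ≤ A ^ 2 * Φ * (C * (A - Φ) * mt) := by
    have := mul_le_mul_of_nonneg_left h2 (mul_nonneg (sq_nonneg A) hΦ0)
    nlinarith [this]
  have t2 : A ^ 2 * (A - Φ) * (C * Φ * mt) ≤ A * (1 - A * Φ) * (C * Φ * mt) :=
    mul_le_mul_of_nonneg_right h3a (mul_nonneg (mul_nonneg hC0 hΦ0) hmt0)
  have t3 : A * (1 - A * Φ) * (C * Φ * mt) ≤ (A + C) * (1 - A * Φ) * (C * Φ * mt) := by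
    have : 0 ≤ C * (1 - A * Φ) * (C * Φ * mt) := mul_nonneg (mul_nonneg hC0 hAΦ) (mul_nonneg (mul_nonneg hC0 hΦ0) hmt0)
    nlinarith [this]
  have t4 : (A + C) * mt * ((1 - A * Φ) * (C * Φ)) ≤ (Φ + m) * ((1 - A * Φ) * (C * Φ)) :=
    mul_le_mul_of_nonneg_right hΦm (mul_nonneg hAΦ (mul_nonneg hC0 hΦ0))
  have t5 : 0 ≤ -cb * (C * (1 - A)) := mul_nonneg (neg_nonneg.2 hcb0) (mul_nonneg hC0 (sub_nonneg.2 hA1))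
  have hW : 0 ≤ C * (Φ * (Φ + m) - cb) * (1 - A) + C * A * Φ * (Φ + m) * (1 - Φ)
      - s * A ^ 2 * C * Φ ^ 2 * (π₁ - m₁) := by
    linear_combination t1 + t2 + t3 + t4 + t5
  -- the decomposition  Φκ̂ = piece₁ + (ε₁ − m₁)·W
  have hdec : (Φ ^ 2 * σ - cb) * (A * (π₁ - m₁)) + (Φ * (Φ + m) - cb) * (C * (ε₁ - m₁))
        - (Φ ^ 2 * (Φ + m) - cb) * (A * C * (π₁ + ε₁ - 2 * m₁))
      = A * (π₁ - m₁) * (1 - C) * (Φ ^ 2 * π - cb)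
        + (ε₁ - m₁) * (C * (Φ * (Φ + m) - cb) * (1 - A) + C * A * Φ * (Φ + m) * (1 - Φ)
            - s * A ^ 2 * C * Φ ^ 2 * (π₁ - m₁)) := by
    rw [hσ, hcb, hΦ, hπ, hε, hm, hpt, het, hmt]; ring
  rw [hdec]
  exact add_nonneg h1 (mul_nonneg (sub_nonneg.2 hmε) hW)

set_option maxHeartbeats 800000 in
/-- **THEOREM K (the depth-`j` condition of THEOREM Θ⁻), polynomial form** (memo PROOF-THETA-G24 §5).  At depth `j` of a path-end block
let `a = A_{[0,j]}`, `c' = C_{[0,j]}`, `S = s₁⋯s_j`, `s' = s_{j+1}`, let `(π₂, ε₂, m₂)` be the in-moments of `T_{j+1}` (`0 ≤ m₂ ≤ π₂, ε₂`,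
`Φ₂ = π₂+ε₂−m₂ ≤ 1`), `pt, et, mt` the unit-root moments `(1−s')Φ₂ + s'(π₂,ε₂,m₂)`, and `Π, E, M ≥ 0` the prefix sums `Σ_{k<j} ω_k p_k (C, A, AC)_{[0,k]}`
(`c'E ≤ M ≤ E`, `E ≤ 1−S`).  The moments of `T` are `π = Π + S c' pt`, `ε = E + S a et`, `m = M + S a c' mt`; `Φ = π+ε−m ≤ 1`, `σ = π+m`, `cb := cΦ = (ε−m)(πΦ−m)`.
If `πΦ ≤ m` (the sign condition `c ≤ 0`) then
`Φ·κ̂_j = (Φ²σ − cb)·a(π₂−m₂) + (Φ(Φ+m) − cb)·c'(ε₂−m₂) − (Φ²(Φ+m) − cb)·ac'(π₂+ε₂−2m₂) ≥ 0`.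
Together with the reduction identity of the memo (§4: `−ω_jU_j = s'(1−s')[S·κ̂_j − Σ_{j'<j} c_{j,j'} U_{j'}]`, `c_{j,j'} ≥ 0`) this gives THEOREM Θ⁻:
the θ‴ class density `G₀` of every path-end block with `c ≤ 0` is ancestor-transport feasible.  The proof is the memo's two-step chain:
`P₁ − N_a − N₀ = a(π₂−m₂)[(1−c')(Φ²π − cb) + Φ²(M − c'E)] ≥ 0` and `P₂+P₃−N_b = c'(ε₂−m₂)·ΦW`, `ΦW ≥ Φ·{Φ[(1+π)(1−aΦ) − a²G] + (m−πΦ)(1−aΦ)} ≥ 0`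
with `G = S s'(π₂−m₂) = S(Φ₂ − et) ≤ 1 − ε` and `a²(1−ε) ≤ (1+π)(1−aΦ)`. [cite: KozmaNitzan2024, Question 8 (§5.5 p. 36)] -/
theorem theta_kappa_nonneg (a c' S s' Pp E M π₂ ε₂ m₂ pt et mt π ε m Φ σ cb : ℝ)
    (hpt : pt = (1 - s') * (π₂ + ε₂ - m₂) + s' * π₂) (het : et = (1 - s') * (π₂ + ε₂ - m₂) + s' * ε₂)
    (hmt : mt = (1 - s') * (π₂ + ε₂ - m₂) + s' * m₂)
    (hπ : π = Pp + S * c' * pt) (hε : ε = E + S * a * et) (hm : m = M + S * a * c' * mt) (hΦ : Φ = π + ε - m) (hσ : σ = π + m)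
    (hcb : cb = (ε - m) * (π * Φ - m))
    (ha0 : 0 ≤ a) (ha1 : a ≤ 1) (hc0 : 0 ≤ c') (hc1 : c' ≤ 1) (hS0 : 0 ≤ S) (hs0 : 0 ≤ s') (hs1 : s' ≤ 1)
    (hP0 : 0 ≤ Pp) (hM0 : 0 ≤ M) (hME : M ≤ E) (hcE : c' * E ≤ M) (hES : E ≤ 1 - S)
    (hm₂0 : 0 ≤ m₂) (hm₂π : m₂ ≤ π₂) (hm₂ε : m₂ ≤ ε₂) (hΦ₂ : π₂ + ε₂ - m₂ ≤ 1) (hΦ1 : Φ ≤ 1) (hc : π * Φ ≤ m) :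
    0 ≤ (Φ ^ 2 * σ - cb) * (a * (π₂ - m₂)) + (Φ * (Φ + m) - cb) * (c' * (ε₂ - m₂))
        - (Φ ^ 2 * (Φ + m) - cb) * (a * c' * (π₂ + ε₂ - 2 * m₂)) := by
  -- elementary bounds
  have hΦ₂0 : 0 ≤ π₂ + ε₂ - m₂ := by linarith
  have hmt0 : 0 ≤ mt := by rw [hmt]; nlinarith
  have hptmt : mt ≤ pt := by rw [hmt, hpt]; nlinarith
  have hetmt : mt ≤ et := by rw [hmt, het]; nlinarith
  have het0 : 0 ≤ et := le_trans hmt0 hetmt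
  have hE0 : 0 ≤ E := le_trans hM0 hME
  have hπ0 : 0 ≤ π := by
    rw [hπ]; nlinarith [mul_nonneg (mul_nonneg hS0 hc0) (le_trans hmt0 hptmt)]
  have hΦ0 : 0 ≤ Φ := by
    rw [hΦ, hπ, hε, hm]
    have h1' : S * a * c' * mt ≤ S * a * et := by
      have : c' * mt ≤ et := by nlinarith [mul_le_mul hc1 hetmt hmt0 (by norm_num : (0:ℝ) ≤ 1)]
      nlinarith [mul_le_mul_of_nonneg_left this (mul_nonneg hS0 ha0)]
    nlinarith [mul_nonneg (mul_nonneg hS0 hc0) (le_trans hmt0 hptmt)]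
  -- D = ε − m ≥ 0 and cb ≤ 0
  have hD : 0 ≤ ε - m := by
    rw [hε, hm]
    have : c' * mt ≤ et := by nlinarith [mul_le_mul hc1 hetmt hmt0 (by norm_num : (0:ℝ) ≤ 1)]
    nlinarith [mul_le_mul_of_nonneg_left this (mul_nonneg hS0 ha0)]
  have hcb0 : cb ≤ 0 := by
    rw [hcb]
    exact mul_nonpos_iff.2 (Or.inl ⟨hD, by linarith⟩)
  -- STEP 1
  have h1 : 0 ≤ a * (π₂ - m₂) * ((1 - c') * (Φ ^ 2 * π - cb) + Φ ^ 2 * (M - c' * E)) := by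
    have hp : 0 ≤ Φ ^ 2 * π - cb := by nlinarith [mul_nonneg (sq_nonneg Φ) hπ0]
    have hq : 0 ≤ Φ ^ 2 * (M - c' * E) := mul_nonneg (sq_nonneg Φ) (by linarith)
    exact mul_nonneg (mul_nonneg ha0 (sub_nonneg.2 hm₂π)) (add_nonneg (mul_nonneg (sub_nonneg.2 hc1) hp) hq)
  -- STEP 2: G = S s'(π₂ − m₂) ≤ 1 − ε  and the chain
  have hG : S * s' * (π₂ - m₂) = S * ((π₂ + ε₂ - m₂) - et) := by rw [het]; ring
  have hT4 : S * s' * (π₂ - m₂) ≤ 1 - ε := by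
    rw [hG, hε]
    have h2' : S * a * et ≤ S * et := by nlinarith [mul_nonneg hS0 het0, mul_le_mul_of_nonneg_left ha1 (mul_nonneg hS0 het0)]
    nlinarith [mul_le_mul_of_nonneg_left hΦ₂ hS0]
  have hεΦ : 1 - ε = 1 + π - m - Φ := by rw [hΦ]; ring
  have hAΦ : 0 ≤ 1 - a * Φ := by nlinarith [mul_le_mul ha1 hΦ1 hΦ0 (by norm_num : (0:ℝ) ≤ 1)]
  have hkey : a ^ 2 * (S * s' * (π₂ - m₂)) ≤ (1 + π) * (1 - a * Φ) := by
    have h3' : a ^ 2 * (S * s' * (π₂ - m₂)) ≤ a ^ 2 * (1 + π - m - Φ) := by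
      rw [← hεΦ]; exact mul_le_mul_of_nonneg_left hT4 (sq_nonneg a)
    have h4' : a ^ 2 * (1 + π - m - Φ) ≤ (1 + π) * (1 - a * Φ) := by
      nlinarith [mul_nonneg (mul_nonneg (by linarith : (0:ℝ) ≤ 1 + π) (sub_nonneg.2 ha1)) (by nlinarith : (0:ℝ) ≤ 1 + a - a * Φ),
                 mul_nonneg (sq_nonneg a) (sub_nonneg.2 hc)]
    linarith
  have hW0 : 0 ≤ Φ * ((Φ + m) * (1 - a * Φ) - a ^ 2 * Φ * (S * s' * (π₂ - m₂))) := by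
    have hin : 0 ≤ (1 + π) * (1 - a * Φ) - a ^ 2 * (S * s' * (π₂ - m₂)) := by linarith
    have e : (Φ + m) * (1 - a * Φ) - a ^ 2 * Φ * (S * s' * (π₂ - m₂))
        = Φ * ((1 + π) * (1 - a * Φ) - a ^ 2 * (S * s' * (π₂ - m₂))) + (m - π * Φ) * (1 - a * Φ) := by ring
    rw [e]
    exact mul_nonneg hΦ0 (add_nonneg (mul_nonneg hΦ0 hin) (mul_nonneg (sub_nonneg.2 hc) hAΦ))
  have hW : 0 ≤ (Φ * (Φ + m) - cb) * (1 - a) + a * Φ * (Φ + m) * (1 - Φ) - a ^ 2 * Φ ^ 2 * (S * s' * (π₂ - m₂)) := by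
    have e : (Φ * (Φ + m) - cb) * (1 - a) + a * Φ * (Φ + m) * (1 - Φ) - a ^ 2 * Φ ^ 2 * (S * s' * (π₂ - m₂))
        = Φ * ((Φ + m) * (1 - a * Φ) - a ^ 2 * Φ * (S * s' * (π₂ - m₂))) + (-cb) * (1 - a) := by ring
    rw [e]
    exact add_nonneg hW0 (mul_nonneg (neg_nonneg.2 hcb0) (sub_nonneg.2 ha1))
  -- the decomposition  Φκ̂_j = STEP-1 piece + c'(ε₂ − m₂)·ΦW
  have hdec : (Φ ^ 2 * σ - cb) * (a * (π₂ - m₂)) + (Φ * (Φ + m) - cb) * (c' * (ε₂ - m₂))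
        - (Φ ^ 2 * (Φ + m) - cb) * (a * c' * (π₂ + ε₂ - 2 * m₂))
      = a * (π₂ - m₂) * ((1 - c') * (Φ ^ 2 * π - cb) + Φ ^ 2 * (M - c' * E))
        + c' * (ε₂ - m₂) * ((Φ * (Φ + m) - cb) * (1 - a) + a * Φ * (Φ + m) * (1 - Φ)
            - a ^ 2 * Φ ^ 2 * (S * s' * (π₂ - m₂))) := by
    -- only σ = π + m, E = Φ − π + m − S a et, M = m − S a c' mt and et − mt = s'(ε₂ − m₂) are needed
    have hE : E = Φ - π + m - S * a * et := by linarith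
    have hM : M = m - S * a * c' * mt := by linarith
    have hem : et = mt + s' * (ε₂ - m₂) := by rw [het, hmt]; ring
    rw [hσ, hE, hM, hem]; ring
  rw [hdec]
  exact add_nonneg h1 (mul_nonneg (mul_nonneg hc0 (sub_nonneg.2 hm₂ε)) hW)

/-- **THEOREM Θ⁺ (partial; gen 25) — κ̂ ≥ 0 below the C-threshold, for EITHER sign of the out-defect.**  In the notation of
`theta_kappa_nonneg` (everything multiplied through by `Φ`; `cb = cΦ`), with `u = π₂ − m₂ ≥ 0`, `v = ε₂ − m₂ ≥ 0` the in-moment gaps of the tail and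
`A = A_[0,j]`, `C = C_[0,j]`:  `Φκ̂_j = A·u·[(Φ²σ − cb) − C·(Φ²(Φ+m) − cb)] + C·v·[(Φ(Φ+m) − cb)(1−A) + A·Φ(Φ+m)(1−Φ)]`, so `κ̂_j ≥ 0` as soon as
`C·(Φ²(Φ+m) − cb) ≤ Φ²σ − cb`, i.e. `C_[0,j] ≤ (Φσ − c)/X` with `X = (Φ+m)Φ − c` (and `cb ≤ Φ(Φ+m)`, `0 ≤ Φ ≤ 1`, `m ≥ 0`).  Since `C_[0,j]` is non-increasing
in `j`, a block with `C_a ≤ (Φσ−c)/X` has `κ̂_j ≥ 0` at every depth, hence (reduction identity of PROOF-THETA-G24 §4) all subtree sums `U_j ≤ 0`: the θ‴ class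
density `G₀` is ancestor-transport feasible — the first `c > 0` instance of CONJECTURE Θ (memo FINDING-G25 §5b).  For `c > 0` the negative `κ̂_j` are
confined to the initial segment of depths with `C_[0,j] > (Φσ−c)/X` (the face neighbourhood `C ≈ 1`). [cite: KozmaNitzan2024, Question 8 (§5.5 p. 36)] -/
theorem theta_kappa_nonneg_of_rootC_small (A C u v Φ σ m cb : ℝ) (hA0 : 0 ≤ A) (hA1 : A ≤ 1) (hC0 : 0 ≤ C) (hu : 0 ≤ u) (hv : 0 ≤ v)
    (hΦ0 : 0 ≤ Φ) (hΦ1 : Φ ≤ 1) (hm : 0 ≤ m) (hK3 : cb ≤ Φ * (Φ + m)) (hC : C * (Φ ^ 2 * (Φ + m) - cb) ≤ Φ ^ 2 * σ - cb) :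
    0 ≤ (Φ ^ 2 * σ - cb) * (A * u) + (Φ * (Φ + m) - cb) * (C * v) - (Φ ^ 2 * (Φ + m) - cb) * (A * C * (u + v)) := by
  have key : (Φ ^ 2 * σ - cb) * (A * u) + (Φ * (Φ + m) - cb) * (C * v) - (Φ ^ 2 * (Φ + m) - cb) * (A * C * (u + v))
      = A * u * ((Φ ^ 2 * σ - cb) - C * (Φ ^ 2 * (Φ + m) - cb))
        + C * v * ((Φ * (Φ + m) - cb) * (1 - A) + A * (Φ * (Φ + m) * (1 - Φ))) := by ring
  rw [key]
  have h1 : 0 ≤ A * u * ((Φ ^ 2 * σ - cb) - C * (Φ ^ 2 * (Φ + m) - cb)) :=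
    mul_nonneg (mul_nonneg hA0 hu) (by linarith)
  have h2 : 0 ≤ (Φ * (Φ + m) - cb) * (1 - A) + A * (Φ * (Φ + m) * (1 - Φ)) := by
    have hK3' : 0 ≤ Φ * (Φ + m) - cb := by linarith
    have h1A : 0 ≤ 1 - A := by linarith
    have hK4 : 0 ≤ Φ * (Φ + m) * (1 - Φ) := mul_nonneg (mul_nonneg hΦ0 (by linarith)) (by linarith)
    exact add_nonneg (mul_nonneg hK3' h1A) (mul_nonneg hA0 hK4)
  exact add_nonneg h1 (mul_nonneg (mul_nonneg hC0 hv) h2)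

/-- **Tail-gap step identities (gen 25).**  For the tail `T_{j+1} = b –s″– T_{j+2}` with vertex marks `(A_b, C_b)`: if `π₂ = C_b((1−s″)Φ₃ + s″π₃)`,
`ε₂ = A_b((1−s″)Φ₃ + s″ε₃)`, `m₂ = A_bC_b((1−s″)Φ₃ + s″m₃)` and `m̃ := (1−s″)Φ₃ + s″m₃`, then the in-moment gaps satisfy
`π₂ − m₂ = C_b(s″(π₃−m₃) + (1−A_b)m̃)` and `ε₂ − m₂ = A_b(s″(ε₃−m₃) + (1−C_b)m̃)`. [cite: KozmaNitzan2024, Question 8 (§5.5 p. 36)] -/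
theorem tail_gap_step (Ab Cb s Φ₃ π₃ ε₃ m₃ π₂ ε₂ m₂ mt : ℝ)
    (hπ : π₂ = Cb * ((1 - s) * Φ₃ + s * π₃)) (hε : ε₂ = Ab * ((1 - s) * Φ₃ + s * ε₃)) (hm : m₂ = Ab * Cb * ((1 - s) * Φ₃ + s * m₃))
    (hmt : mt = (1 - s) * Φ₃ + s * m₃) :
    π₂ - m₂ = Cb * (s * (π₃ - m₃) + (1 - Ab) * mt) ∧ ε₂ - m₂ = Ab * (s * (ε₃ - m₃) + (1 - Cb) * mt) := by
  constructor
  · rw [hπ, hm, hmt]; ring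
  · rw [hε, hm, hmt]; ring

/-- **Monotone gap ratio, sufficient condition (gen 25).**  With `u₃ = π₃−m₃ ≥ 0`, `v₃ = ε₃−m₃ ≥ 0`, `m̃ ≥ 0`, `s″ ≥ 0` and the step identities of
`tail_gap_step`, the tail gap ratio does not decrease from `T_{j+1}` to `T_{j+2}` — `v₃·u₂ ≥ u₃·v₂` — as soon as `C_b ≥ A_b` and
`C_b(1−A_b)v₃ ≥ A_b(1−C_b)u₃`; in particular whenever `C_b = 1`. [cite: KozmaNitzan2024, Question 8 (§5.5 p. 36)] -/
theorem tail_gap_ratio_monotone (Ab Cb s u₃ v₃ mt : ℝ) (hs : 0 ≤ s) (hu : 0 ≤ u₃) (hv : 0 ≤ v₃) (hmt : 0 ≤ mt)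
    (hAC : Ab ≤ Cb) (hcross : Ab * (1 - Cb) * u₃ ≤ Cb * (1 - Ab) * v₃) :
    u₃ * (Ab * (s * v₃ + (1 - Cb) * mt)) ≤ v₃ * (Cb * (s * u₃ + (1 - Ab) * mt)) := by
  have h1 : 0 ≤ s * u₃ * v₃ * (Cb - Ab) := by
    have := mul_nonneg (mul_nonneg (mul_nonneg hs hu) hv) (sub_nonneg.2 hAC); linarith
  have h2 : 0 ≤ mt * (Cb * (1 - Ab) * v₃ - Ab * (1 - Cb) * u₃) := mul_nonneg hmt (sub_nonneg.2 hcross)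
  nlinarith [h1, h2]

/-- **THEOREM (SSC(κ̂), monotone-ratio case; gen 25).**  Symmetric form of the depth quantity: `κ̂_j/(A_jC_j) = v₂·G − u₂·H` with
`G = (Φ+m−c)/A_j − X ≥ 0` non-decreasing in `j`, `H = X − (Φσ−c)/C_j` non-increasing in `j` (`X = (Φ+m)Φ − c`), `u₂ = π″−m″`, `v₂ = ε″−m″` the gaps of
`T_{j+1}`, and at depth `j+1` the same with `G′ ≥ G`, `H′ ≤ H` and the gaps `u₃, v₃` of `T_{j+2}`.  If `κ̂_j ≥ 0` (`u₂H ≤ v₂G`) and the gap ratio does not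
decrease (`u₃v₂ ≤ v₃u₂`, e.g. by `tail_gap_ratio_monotone`), then `κ̂_{j+1} ≥ 0` (`u₃H′ ≤ v₃G′`).  So the sign of `κ̂` cannot return to negative across such a
step: the single-sign-change property SSC(κ̂) of FINDING-G25 §5b at every step past a vertex with `C_b = 1` (86 % of all nontrivial steps in the census).
[cite: KozmaNitzan2024, Question 8 (§5.5 p. 36)] -/
theorem theta_kappa_step_of_ratio (u₂ v₂ u₃ v₃ G G' H H' : ℝ) (hu₂ : 0 < u₂) (hu₃ : 0 ≤ u₃) (hv₃ : 0 ≤ v₃)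
    (hG : 0 ≤ G) (hGG : G ≤ G') (hHH : H' ≤ H) (hF : u₂ * H ≤ v₂ * G) (hratio : u₃ * v₂ ≤ v₃ * u₂) :
    u₃ * H' ≤ v₃ * G' := by
  -- u₂·(u₃H′) ≤ u₂u₃H ≤ u₃·v₂G ≤ v₃u₂·G ≤ u₂·(v₃G′)
  have h1 : u₂ * (u₃ * H') ≤ u₃ * (u₂ * H) := by nlinarith [mul_le_mul_of_nonneg_left hHH hu₃]
  have h2 : u₃ * (u₂ * H) ≤ u₃ * (v₂ * G) := mul_le_mul_of_nonneg_left hF hu₃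
  have h3 : u₃ * (v₂ * G) ≤ v₃ * u₂ * G := by nlinarith [mul_le_mul_of_nonneg_right hratio hG]
  have h4 : v₃ * u₂ * G ≤ u₂ * (v₃ * G') := by nlinarith [mul_le_mul_of_nonneg_left hGG (mul_nonneg hv₃ hu₂.le)]
  have h5 : u₂ * (u₃ * H') ≤ u₂ * (v₃ * G') := le_trans (le_trans (le_trans h1 h2) h3) h4
  exact le_of_mul_le_mul_left h5 hu₂

end PocketCert

end Summit.CriticalPhenomena.PercolationContinuityZ3.Theorems
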